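import Literature.NumberTheory.Automorphic.Liu2021.FinAdelicCheckSurjective
import Literature.NumberTheory.Automorphic.AdelicSecondCountable
import Literature.NumberTheory.Automorphic.AdicCompletionCompact
import Mathlib.Topology.Algebra.Group.OpenMapping
import HarnessLib

/-!
# Descent of characters through `u ↦ u / uᶜ`: characters of `U(1)(𝔸_{F,f})` = characters of `(𝔸_E^∞)ˣ` trivial on the `c`-fixed idèles

Topic `NumberTheory/Automorphic/Liu2021`; namespace `Literature.NumberTheory.Automorphic.Liu2021`.  THEOREMS ONLY (no definition,
no instance, no named fact, no `sorry`).  Sequel of ★ `FinAdelicCheckSurjective` (Hilbert 90 for the finite-adelic centre: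
`finAdelicCheck F E c hcc : (𝔸_E^∞)ˣ →* U(1)(𝔸_{F,f})`, `u ↦ u/uᶜ`, is SURJECTIVE with kernel the `c`-fixed idèles).

SETTING.  `E/F` number fields, `c : E ≃ₐ[F] E`, `hcc : c * c = 1`, `hc : c ≠ 1`; `ν : (𝔸_E^∞)ˣ →* M` a homomorphism killed by
the `c`-fixed finite idèles (`hν : ∀ u, c • u = u → ν u = 1`).

* §1 ALGEBRAIC DESCENT. **`existsUnique_comp_finAdelicCheck`**: there is a unique `χ : U(1)(𝔸_{F,f}) →* M` with
  `χ ∘ (u ↦ u/uᶜ) = ν` (Mathlib `MonoidHom.liftOfSurjective` over ★ `finAdelicCheck_surjective` and ★ `finAdelicCheck_eq_one_iff`);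
  the values of `χ` are values of `ν` (`forall_of_comp_finAdelicCheck_eq`), in particular UNITARITY transfers value-wise
  (`norm_eq_one_of_comp_finAdelicCheck_eq`).
* §2 TOPOLOGY. **`isOpenMap_finAdelicCheck`** — `u ↦ u/uᶜ` is OPEN (open-mapping theorem for σ-compact locally compact groups,
  Mathlib `MonoidHom.isOpenMap_of_sigmaCompact`: `(𝔸_E^∞)ˣ` is second countable and locally compact (tree ★
  `secondCountableTopology_finiteAdeleRing`, ★ `locallyCompactSpace_finiteAdeleRing'`), `U(1)(𝔸_{F,f})` is a closed subgroup
  (`isClosed_finAdelicOne`) hence locally compact Hausdorff, hence Baire); so it is an open quotient map and a homomorphism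
  `χ` on `U(1)(𝔸_{F,f})` is continuous iff `χ ∘ (u ↦ u/uᶜ)` is (**`continuous_iff_comp_finAdelicCheck`**,
  `continuous_of_comp_finAdelicCheck_eq`).
* §3 AUTOMORPHY TRANSFER. A rational norm-one element `x ∈ E¹` is `b / bᶜ` for some `b ∈ Eˣ` (global Hilbert 90,
  `exists_finAdelicCheck_algebraMap_eq`); hence if `ν` is continuous and TRIVIAL ON THE PRINCIPAL FINITE IDÈLES `(b)_f`, `b ∈ Eˣ`,
  its descent is an automorphic character of `E¹ \ U(1)(𝔸_{F,f})` in the sense of ★ `IsAutomorphicOneChar`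
  (**`isAutomorphicOneChar_of_comp_finAdelicCheck_eq`**).  (For the finite part `ν = Λ_f` of a Hecke character `Λ` of `E`
  the hypothesis «`Λ_f` trivial on `Eˣ`» says `Λ_∞ = 1` — archimedean input, kept explicit on purpose.)

Cell `hodgecm-mathlib` FLOOR 0 programme P2, row «U1-DESCENT» (consumer: the witness `grdChi := (existsUnique_comp_finAdelicCheck …).choose`
of `Theorems/F0P2iGRDWitness`, and RIG∞'s automorphy clause); `--supports stmt-HodgeConjecture-24833`.  HC_CM is proved only modulo the
printed citations until rung 0 closes; this file is idelic number theory.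

## Mathlib / tree search

Mathlib: `MonoidHom.liftOfSurjective` / `liftOfRightInverse_comp` (Algebra/Group/Subgroup/Basic), `MonoidHom.isOpenMap_of_sigmaCompact`
(Topology/Algebra/Group/OpenMapping), `IsOpenMap.isQuotientMap`, `IsQuotientMap.continuous_iff`, `Units.isEmbedding_embedProduct`,
the `LocallyCompactSpace αˣ` instance, `sigmaCompactSpace_of_locallyCompact_secondCountable`, `isClosed_eq`.  Tree: ★
`FinAdelicCheckSurjective` (this row's FILE 1), ★ `AdelicSecondCountable`, ★ `AdicCompletionCompact`, ★ `GaloisActionAdeleRing.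
FiniteAdeleRing.smul_algebraMap`, ★ `UnitaryShimuraCurveCentralTranslate.galConj_mul_self_eq_one_of_mem_finAdelicOne` (the CM special
case of `apply_mul_self_eq_one_of_mem_finAdelicOne`; that file's heavy Shimura-curve imports are why the generic statement is re-proved here).

## References
* [CasselsFrohlichANT1967] Cassels–Fröhlich (eds.), *Algebraic Number Theory* (1967): Ch. V (Serre) §2.7 Prop. 5 (Hilbert 90); Ch. VII
  (Tate) §7.3 Prop. (a).
* [Mok2014] C. P. Mok, Mem. AMS 235 (2015), §1 Notation p. 5 (`U_{E/F}(1)`, its centre characters).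
* [Liu2021] Y. Liu, Camb. J. Math. 9 (2021), Def. 4.11 (automorphic characters of `E¹\(𝔸_E^∞)¹`), App. D §D.1 (`χ̌(x) = χ(x/xᶜ)`).
* [Bourbaki1989GeneralTopology2] N. Bourbaki, *General Topology*, Chapters 5–10 (1989), Ch. IX §5 (open-mapping theorem for σ-compact
  locally compact groups; Baire).
-/

set_option autoImplicit false

noncomputable section

open NumberField IsDedekindDomain Topology

namespace Literature.NumberTheory.Automorphic.Liu2021

open Literature.NumberTheory.Automorphic.UnitaryGroup
open Literature.NumberTheory.Automorphic.Liu2021.Def411WeilCarriers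

section Generic

variable (F E : Type) [Field F] [NumberField F] [Field E] [NumberField E] [Algebra F E] (c : E ≃ₐ[F] E)

/-! ## §1 Algebraic descent -/

omit [NumberField F] in
/-- A homomorphism killed by the `c`-fixed finite idèles is killed by the kernel of `u ↦ u/uᶜ` (★ `finAdelicCheck_eq_one_iff`).
[cite: CasselsFrohlichANT1967, Ch. VII §7.3 Prop. (a)] -/
theorem ker_finAdelicCheck_le_ker {M : Type*} [Group M] (hcc : c * c = 1) (ν : (FiniteAdeleRing (𝓞 E) E)ˣ →* M)
    (hν : ∀ u : (FiniteAdeleRing (𝓞 E) E)ˣ, c • (u : FiniteAdeleRing (𝓞 E) E) = u → ν u = 1) :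
    (finAdelicCheck F E c hcc).ker ≤ ν.ker := fun u hu => by
  rw [MonoidHom.mem_ker] at hu ⊢
  exact hν u ((finAdelicCheck_eq_one_iff F E c hcc u).1 hu)

omit [NumberField F] in
/-- Evaluation of a descended homomorphism: `χ (u/uᶜ) = ν u` whenever `χ ∘ (u ↦ u/uᶜ) = ν`. [cite: Liu2021, App. D §D.1 (l. 5224)] -/
theorem apply_finAdelicCheck_of_comp_eq {M : Type*} [MulOneClass M] (hcc : c * c = 1) {χ : finAdelicOne F E c →* M}
    {ν : (FiniteAdeleRing (𝓞 E) E)ˣ →* M} (h : χ.comp (finAdelicCheck F E c hcc) = ν) (u : (FiniteAdeleRing (𝓞 E) E)ˣ) :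
    χ (finAdelicCheck F E c hcc u) = ν u := by
  rw [← h, MonoidHom.comp_apply]

/-- UNIQUENESS of the descent: two homomorphisms on `U(1)(𝔸_{F,f})` with the same composite with `u ↦ u/uᶜ` are equal
(`u ↦ u/uᶜ` is surjective, ★ `finAdelicCheck_surjective`). [cite: CasselsFrohlichANT1967, Ch. VII §7.3 Prop. (a)] -/
theorem eq_of_comp_finAdelicCheck_eq {M : Type*} [MulOneClass M] (hcc : c * c = 1) (hc : c ≠ 1)
    {χ χ' : finAdelicOne F E c →* M}
    (h : χ.comp (finAdelicCheck F E c hcc) = χ'.comp (finAdelicCheck F E c hcc)) : χ = χ' := by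
  refine MonoidHom.ext fun z => ?_
  obtain ⟨u, rfl⟩ := finAdelicCheck_surjective F E c hcc hc z
  exact DFunLike.congr_fun h u

/-- **EXISTENCE AND UNIQUENESS OF THE DESCENT.**  A homomorphism `ν : (𝔸_E^∞)ˣ →* M` (`M` a group) killed by the `c`-fixed finite
idèles factors UNIQUELY through `u ↦ u/uᶜ`: `∃! χ : U(1)(𝔸_{F,f}) →* M, χ ∘ (u ↦ u/uᶜ) = ν` (Hilbert 90 for the finite-adelic
centre, ★ `finAdelicCheck_surjective`, and the kernel ★ `finAdelicCheck_eq_one_iff`).  Characters of the centre `U(1)` of the unitary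
groups are thus «characters of `𝔸_Eˣ` trivial on `𝔸_Fˣ`», finite part. [cite: Mok2014, §1 Notation p. 5]
[cite: CasselsFrohlichANT1967, Ch. VII §7.3 Prop. (a)] -/
theorem existsUnique_comp_finAdelicCheck {M : Type*} [Group M] (hcc : c * c = 1) (hc : c ≠ 1)
    (ν : (FiniteAdeleRing (𝓞 E) E)ˣ →* M)
    (hν : ∀ u : (FiniteAdeleRing (𝓞 E) E)ˣ, c • (u : FiniteAdeleRing (𝓞 E) E) = u → ν u = 1) :
    ∃! χ : finAdelicOne F E c →* M, χ.comp (finAdelicCheck F E c hcc) = ν := by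
  have hs := finAdelicCheck_surjective F E c hcc hc
  have hcomp : ((finAdelicCheck F E c hcc).liftOfRightInverse (Function.surjInv hs) (Function.rightInverse_surjInv hs)
      ⟨ν, ker_finAdelicCheck_le_ker F E c hcc ν hν⟩).comp (finAdelicCheck F E c hcc) = ν :=
    (finAdelicCheck F E c hcc).liftOfRightInverse_comp (Function.surjInv hs) (Function.rightInverse_surjInv hs)
      ⟨ν, ker_finAdelicCheck_le_ker F E c hcc ν hν⟩
  refine ⟨(finAdelicCheck F E c hcc).liftOfRightInverse (Function.surjInv hs) (Function.rightInverse_surjInv hs)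
      ⟨ν, ker_finAdelicCheck_le_ker F E c hcc ν hν⟩, hcomp, fun χ hχ => ?_⟩
  exact eq_of_comp_finAdelicCheck_eq F E c hcc hc (hχ.trans hcomp.symm)

/-- The VALUES of a descended homomorphism are values of `ν`: any property of all `ν u` holds for all `χ z`.
[cite: CasselsFrohlichANT1967, Ch. VII §7.3 Prop. (a)] -/
theorem forall_of_comp_finAdelicCheck_eq {M : Type*} [MulOneClass M] (hcc : c * c = 1) (hc : c ≠ 1) {P : M → Prop}
    {χ : finAdelicOne F E c →* M} {ν : (FiniteAdeleRing (𝓞 E) E)ˣ →* M} (h : χ.comp (finAdelicCheck F E c hcc) = ν)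
    (hν : ∀ u, P (ν u)) (z : finAdelicOne F E c) : P (χ z) := by
  obtain ⟨u, rfl⟩ := finAdelicCheck_surjective F E c hcc hc z
  rw [apply_finAdelicCheck_of_comp_eq F E c hcc h]
  exact hν u

/-- UNITARITY transfers value-wise: if `|ν u| = 1` for all `u` then `|χ z| = 1` for all `z`. [cite: Liu2021, Def. 4.11 (l. 2090)] -/
theorem norm_eq_one_of_comp_finAdelicCheck_eq (hcc : c * c = 1) (hc : c ≠ 1) {χ : finAdelicOne F E c →* ℂˣ}
    {ν : (FiniteAdeleRing (𝓞 E) E)ˣ →* ℂˣ} (h : χ.comp (finAdelicCheck F E c hcc) = ν) (hν : ∀ u, ‖((ν u : ℂˣ) : ℂ)‖ = 1)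
    (z : finAdelicOne F E c) : ‖((χ z : ℂˣ) : ℂ)‖ = 1 :=
  forall_of_comp_finAdelicCheck_eq F E c hcc hc (P := fun m : ℂˣ => ‖(m : ℂ)‖ = 1) h hν z

/-! ## §2 `u ↦ u/uᶜ` is an open quotient map; continuity of the descent -/

omit [NumberField F] in
/-- `U(1)(𝔸_{F,f})` is CLOSED in `(𝔸_E^∞)ˣ` (the equation `(c ⊗ 1)(u) · u = 1` between continuous functions to the Hausdorff
`𝔸_E^∞`). [cite: Mok2014, §1 Notation p. 5] -/
theorem isClosed_finAdelicOne : IsClosed (finAdelicOne F E c : Set (FiniteAdeleRing (𝓞 E) E)ˣ) := by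
  haveI : T2Space (FiniteAdeleRing (𝓞 E) E) := inferInstanceAs <| T2Space
    (RestrictedProduct (fun v : HeightOneSpectrum (𝓞 E) => v.adicCompletion E)
      (fun v => (v.adicCompletionIntegers E : Set (v.adicCompletion E))) Filter.cofinite)
  have h1 : Continuous fun u : (FiniteAdeleRing (𝓞 E) E)ˣ => (u : FiniteAdeleRing (𝓞 E) E) := Units.continuous_val
  have h2 : Continuous fun u : (FiniteAdeleRing (𝓞 E) E)ˣ =>
      conjFiniteAdele F E c (u : FiniteAdeleRing (𝓞 E) E) * (u : FiniteAdeleRing (𝓞 E) E) :=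
    ((continuous_conjFiniteAdele F E c).comp h1).mul h1
  exact isClosed_eq h2 continuous_const

/-- **`u ↦ u/uᶜ : (𝔸_E^∞)ˣ → U(1)(𝔸_{F,f})` is an OPEN map** — the open-mapping theorem for the continuous surjection
(★ `finAdelicCheck_surjective`) from the σ-compact locally compact group `(𝔸_E^∞)ˣ` onto the locally compact (closed subgroup)
`U(1)(𝔸_{F,f})`. [cite: Bourbaki1989GeneralTopology2, Ch. IX §5] [cite: CasselsFrohlichANT1967, Ch. VII §7.3 Prop. (a)] -/
theorem isOpenMap_finAdelicCheck (hcc : c * c = 1) (hc : c ≠ 1) : IsOpenMap (finAdelicCheck F E c hcc) := by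
  haveI : SecondCountableTopology (FiniteAdeleRing (𝓞 E) E) := secondCountableTopology_finiteAdeleRing E
  haveI : LocallyCompactSpace (FiniteAdeleRing (𝓞 E) E) := locallyCompactSpace_finiteAdeleRing' E
  haveI : T2Space (FiniteAdeleRing (𝓞 E) E) := inferInstanceAs <| T2Space
    (RestrictedProduct (fun v : HeightOneSpectrum (𝓞 E) => v.adicCompletion E)
      (fun v => (v.adicCompletionIntegers E : Set (v.adicCompletion E))) Filter.cofinite)
  haveI : SecondCountableTopology (FiniteAdeleRing (𝓞 E) E)ᵐᵒᵖ := MulOpposite.opHomeomorph.symm.secondCountableTopology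
  haveI : SecondCountableTopology (FiniteAdeleRing (𝓞 E) E)ˣ := Units.isEmbedding_embedProduct.secondCountableTopology
  haveI : LocallyCompactSpace (FiniteAdeleRing (𝓞 E) E)ˣ := inferInstance
  haveI : LocallyCompactSpace (finAdelicOne F E c) := (isClosed_finAdelicOne F E c).locallyCompactSpace
  exact MonoidHom.isOpenMap_of_sigmaCompact _ (finAdelicCheck_surjective F E c hcc hc) (continuous_finAdelicCheck F E c hcc)

/-- `u ↦ u/uᶜ` is an open quotient map onto `U(1)(𝔸_{F,f})`. [cite: Bourbaki1989GeneralTopology2, Ch. IX §5] -/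
theorem isOpenQuotientMap_finAdelicCheck (hcc : c * c = 1) (hc : c ≠ 1) : IsOpenQuotientMap (finAdelicCheck F E c hcc) :=
  ⟨finAdelicCheck_surjective F E c hcc hc, continuous_finAdelicCheck F E c hcc, isOpenMap_finAdelicCheck F E c hcc hc⟩

/-- **A homomorphism on `U(1)(𝔸_{F,f})` is continuous iff its composite with `u ↦ u/uᶜ` is.** [cite: Bourbaki1989GeneralTopology2, Ch. IX §5] -/
theorem continuous_iff_comp_finAdelicCheck {M : Type*} [MulOneClass M] [TopologicalSpace M] (hcc : c * c = 1) (hc : c ≠ 1)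
    (χ : finAdelicOne F E c →* M) : Continuous χ ↔ Continuous (χ.comp (finAdelicCheck F E c hcc)) :=
  (isOpenQuotientMap_finAdelicCheck F E c hcc hc).isQuotientMap.continuous_iff

/-- CONTINUITY of the descent: `χ ∘ (u ↦ u/uᶜ) = ν` with `ν` continuous ⇒ `χ` continuous. [cite: Bourbaki1989GeneralTopology2, Ch. IX §5] -/
theorem continuous_of_comp_finAdelicCheck_eq {M : Type*} [MulOneClass M] [TopologicalSpace M] (hcc : c * c = 1) (hc : c ≠ 1)
    {χ : finAdelicOne F E c →* M} {ν : (FiniteAdeleRing (𝓞 E) E)ˣ →* M} (h : χ.comp (finAdelicCheck F E c hcc) = ν)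
    (hν : Continuous ν) : Continuous χ := by
  rw [continuous_iff_comp_finAdelicCheck F E c hcc hc, h]
  exact hν

/-! ## §3 Rational norm-one elements and the automorphy transfer -/

omit [NumberField F] [Algebra F E] in
/-- `E → 𝔸_E^∞` is injective (read at one finite place). [folklore] -/
private theorem algebraMap_finiteAdeleRing_injective' : Function.Injective (algebraMap E (FiniteAdeleRing (𝓞 E) E)) := by
  obtain ⟨P, hP⟩ := Ideal.exists_maximal (𝓞 E)
  let v : HeightOneSpectrum (𝓞 E) :=
    ⟨P, hP.isPrime, Ring.ne_bot_of_isMaximal_of_not_isField hP (RingOfIntegers.not_isField E)⟩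
  intro x y hxy
  have h := congrArg (fun z : FiniteAdeleRing (𝓞 E) E => z v) hxy
  simp only [FiniteAdeleRing.algebraMap_apply] at h
  exact (algebraMap E (v.adicCompletion E)).injective h

omit [NumberField F] in
/-- Hilbert's Satz 90 for an involution of a field (`σ² = id`, `σ ≠ id`, `l · σ l = 1 ⇒ ∃ b ≠ 0, l · σ b = b`); private copy of
★ `CentralSimple.AntiInvolutionSecondKind.exists_ne_zero_mul_apply_eq`. [cite: CasselsFrohlichANT1967, Ch. V §2.7 Prop. 5] -/
private theorem exists_ne_zero_mul_apply_eq'' {K : Type*} [Field K] (σ : K →+* K) (hσ : ∀ a, σ (σ a) = a)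
    (hσ1 : ∃ a, σ a ≠ a) {l : K} (hl : l * σ l = 1) : ∃ b : K, b ≠ 0 ∧ l * σ b = b := by
  by_cases hl1 : l = -1
  · subst hl1
    obtain ⟨a, ha⟩ := hσ1
    refine ⟨a - σ a, sub_ne_zero.2 (Ne.symm ha), ?_⟩
    rw [map_sub, hσ, neg_one_mul, neg_sub]
  · refine ⟨1 + l, fun h => hl1 (by linear_combination h), ?_⟩
    rw [map_add, map_one, mul_add, mul_one, hl, add_comm]

omit [NumberField F] in
/-- **A unit `x ∈ E` whose diagonal image is a norm-one finite idèle is of norm one: `c(x) · x = 1`** (the diagonal `E → 𝔸_E^∞`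
is injective and intertwines `c` with `c ⊗ 1`).  Generic form of ★ `galConj_mul_self_eq_one_of_mem_finAdelicOne` (CM case).
[cite: Liu2021, Def. 4.11 (l. 2090)] [cite: Mok2014, §1 Notation p. 5] -/
theorem apply_mul_self_eq_one_of_mem_finAdelicOne (x : Eˣ)
    (hx : Units.map (algebraMap E (FiniteAdeleRing (𝓞 E) E)).toMonoidHom x ∈ finAdelicOne F E c) : c (x : E) * x = 1 := by
  have h := (mem_finAdelicOne_iff F E c _).1 hx
  change conjFiniteAdele F E c (algebraMap E (FiniteAdeleRing (𝓞 E) E) x) * algebraMap E (FiniteAdeleRing (𝓞 E) E) x = 1 at h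
  rw [conjFiniteAdele_apply, FiniteAdeleRing.smul_algebraMap, AlgEquiv.smul_def, ← map_mul,
    ← map_one (algebraMap E (FiniteAdeleRing (𝓞 E) E))] at h
  exact algebraMap_finiteAdeleRing_injective' E h

omit [NumberField F] in
/-- **Global Hilbert 90 for the rational points of the centre**: a rational norm-one element `x ∈ E¹` is `b / bᶜ` for some
`b ∈ Eˣ`, i.e. its diagonal image is `finAdelicCheck` of the principal finite idèle `(b)_f`.
[cite: CasselsFrohlichANT1967, Ch. V §2.7 Prop. 5] -/
theorem exists_finAdelicCheck_algebraMap_eq (hcc : c * c = 1) (hc : c ≠ 1) (x : Eˣ)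
    (hx : Units.map (algebraMap E (FiniteAdeleRing (𝓞 E) E)).toMonoidHom x ∈ finAdelicOne F E c) :
    ∃ b : Eˣ, finAdelicCheck F E c hcc (Units.map (algebraMap E (FiniteAdeleRing (𝓞 E) E)).toMonoidHom b) = ⟨_, hx⟩ := by
  have hx1 : (x : E) * c (x : E) = 1 := by rw [mul_comm]; exact apply_mul_self_eq_one_of_mem_finAdelicOne F E c x hx
  have hσ : ∀ a : E, (c : E →+* E) ((c : E →+* E) a) = a := fun a => by
    change c (c a) = a
    rw [← AlgEquiv.mul_apply, hcc, AlgEquiv.one_apply]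
  have hσ1 : ∃ a : E, (c : E →+* E) a ≠ a := by
    by_contra h
    push Not at h
    exact hc (AlgEquiv.ext h)
  obtain ⟨b, hb0, hb⟩ := exists_ne_zero_mul_apply_eq'' (c : E →+* E) hσ hσ1 (l := (x : E)) hx1
  refine ⟨Units.mk0 b hb0, Subtype.ext ?_⟩
  rw [coe_finAdelicCheck, div_eq_iff_eq_mul]
  refine Units.ext ?_
  change algebraMap E (FiniteAdeleRing (𝓞 E) E) b =
    algebraMap E (FiniteAdeleRing (𝓞 E) E) x * conjFiniteAdele F E c (algebraMap E (FiniteAdeleRing (𝓞 E) E) b)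
  rw [conjFiniteAdele_apply, FiniteAdeleRing.smul_algebraMap, AlgEquiv.smul_def, ← map_mul]
  exact congrArg _ hb.symm

/-- **AUTOMORPHY TRANSFER.**  Let `ν : (𝔸_E^∞)ˣ →* ℂˣ` be continuous and TRIVIAL ON THE PRINCIPAL FINITE IDÈLES `(b)_f`, `b ∈ Eˣ`,
and let `χ` be a homomorphism on `U(1)(𝔸_{F,f})` with `χ ∘ (u ↦ u/uᶜ) = ν`.  Then `χ` is an automorphic character of
`E¹ \ U(1)(𝔸_{F,f})` (★ `IsAutomorphicOneChar`: continuous, and trivial on the rational norm-one elements — each of which is `b/bᶜ`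
by global Hilbert 90). [cite: Liu2021, Def. 4.11 (l. 2090)] [cite: CasselsFrohlichANT1967, Ch. V §2.7 Prop. 5] -/
theorem isAutomorphicOneChar_of_comp_finAdelicCheck_eq (hcc : c * c = 1) (hc : c ≠ 1) {χ : finAdelicOne F E c →* ℂˣ}
    {ν : (FiniteAdeleRing (𝓞 E) E)ˣ →* ℂˣ} (h : χ.comp (finAdelicCheck F E c hcc) = ν) (hν : Continuous ν)
    (hνE : ∀ b : Eˣ, ν (Units.map (algebraMap E (FiniteAdeleRing (𝓞 E) E)).toMonoidHom b) = 1) :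
    IsAutomorphicOneChar F E c χ := by
  refine ⟨continuous_of_comp_finAdelicCheck_eq F E c hcc hc h hν, fun x hx => ?_⟩
  obtain ⟨b, hb⟩ := exists_finAdelicCheck_algebraMap_eq F E c hcc hc x hx
  rw [← hb, apply_finAdelicCheck_of_comp_eq F E c hcc h]
  exact hνE b

/-- The automorphy transfer packaged as an element of ★ `Chi F E c` (the index type of Liu's `χ`): the descent of a continuous
`ν` trivial on the `c`-fixed and on the principal finite idèles. [cite: Liu2021, Def. 4.11 (l. 2090)] -/
theorem exists_chi_comp_finAdelicCheck_eq (hcc : c * c = 1) (hc : c ≠ 1) (ν : (FiniteAdeleRing (𝓞 E) E)ˣ →* ℂˣ) (hν : Continuous ν)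
    (hνc : ∀ u : (FiniteAdeleRing (𝓞 E) E)ˣ, c • (u : FiniteAdeleRing (𝓞 E) E) = u → ν u = 1)
    (hνE : ∀ b : Eˣ, ν (Units.map (algebraMap E (FiniteAdeleRing (𝓞 E) E)).toMonoidHom b) = 1) :
    ∃ χ : Chi F E c, (χ : finAdelicOne F E c →* ℂˣ).comp (finAdelicCheck F E c hcc) = ν := by
  obtain ⟨χ, hχ, -⟩ := existsUnique_comp_finAdelicCheck F E c hcc hc ν hνc
  exact ⟨⟨χ, isAutomorphicOneChar_of_comp_finAdelicCheck_eq F E c hcc hc hχ hν hνE⟩, hχ⟩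

end Generic

end Literature.NumberTheory.Automorphic.Liu2021

end
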